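import Summits.KontsevichZagierPeriods.KontsevichZagierPeriods.Theorems.SoloInformedTameMapSlackFamilies
import HarnessLib

/-!
# Tame dissections up to sets of empty interior — slack validity

For a nonlinear tame shape `σ : SoloInformedTameMapShape K n N` (file `SoloInformedTameMapFamilies`)
and a source `D₀ ⊆ ℝⁿ`, the predicate `σ.SlackValid D₀ p` on the real parameter `p` says: sides
`≥ 0`; pieces `⊆ D₀`; pairwise intersections of pieces THIN (empty interior); the uncovered part of
`D₀` THIN; functional graphs (existence, uniqueness) into the box; pairwise intersections of the
images THIN; the uncovered part of the box THIN; injectivity on each piece; the first-order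
differentiability clause `σ.DiffOK i p` of `SoloInformedTameMapDiff` on each piece. It is
`ℚ`-semialgebraic in `p` (`isSemialgebraic_setOf_slackValid`: finitely many Tarski–Seidenberg
projections, through the thin-fibre clause `soloInformedThin` of `SoloInformedTameMapSlackFamilies`)
and `slackValid_iff` unfolds it in terms of pieces, images, relations and sides.

References: [cite: BochnakCosteRoy1998, §2.2, Prop. 2.2.4]; Tarski (1951).
-/

noncomputable section

open Set MvPolynomial Literature.ModelTheory.ExponentialFields

namespace Summit.KontsevichZagierPeriods.KontsevichZagierPeriods.Theorems

namespace SoloInformedTameMapShape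

variable {K : Type*} {n N : ℕ} (σ : SoloInformedTameMapShape K n N) {D₀ : Set (Fin n → ℝ)}

/-! ### Slack validity -/

/-- **Slack validity** of the parameter `p` for the source `D₀`: sides `≥ 0`; pieces inside `D₀`,
overlapping and missing only sets of empty interior; functional graphs into the box whose images
overlap and miss only sets of empty interior; injectivity on each piece; the first-order
differentiability clause on each piece. [folklore] -/
def SlackValid (D₀ : Set (Fin n → ℝ)) (p : K → ℝ) : Prop :=
  (∀ j, 0 ≤ σ.side p j) ∧
  (∀ i, ∀ x : Fin n → ℝ, Sum.elim p x ∈ σ.subSet D₀ i) ∧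
  (∀ i i', i ≠ i' → soloInformedThin (σ.S i ∩ σ.S i') p) ∧
  soloInformedThin (σ.restFam D₀) p ∧
  (∀ i, ∀ x : Fin n → ℝ, Sum.elim p x ∈ σ.exSet i) ∧
  (∀ i, ∀ z : Fin n ⊕ (Fin n ⊕ Fin n) → ℝ, Sum.elim p z ∈ σ.uniqSet i) ∧
  (∀ i, ∀ z : Fin n ⊕ Fin n → ℝ, Sum.elim p z ∈ σ.intoSet i) ∧
  (∀ i i', i ≠ i' → soloInformedThin (σ.imgFam i ∩ σ.imgFam i') p) ∧
  soloInformedThin σ.imgRestFam p ∧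
  (∀ i, ∀ z : Fin n ⊕ (Fin n ⊕ Fin n) → ℝ, Sum.elim p z ∈ σ.injSet i i) ∧
  (∀ i, σ.DiffOK i p)

/-- **Slack validity is `ℚ`-semialgebraic in the parameter.**
[cite: BochnakCosteRoy1998, Prop. 2.2.4] -/
theorem isSemialgebraic_setOf_slackValid [Finite K] (hS : ∀ i, IsSemialgebraic ℚ (σ.S i))
    (hG : ∀ i, IsSemialgebraic ℚ (σ.G i)) (hD₀ : IsSemialgebraic ℚ D₀) :
    IsSemialgebraic ℚ {p : K → ℝ | σ.SlackValid D₀ p} := by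
  unfold SlackValid
  refine soloInformed_isSemialgebraic_setOf_and
    (soloInformed_isSemialgebraic_setOf_forall fun j => ?_) ?_
  · simpa only [side] using isSemialgebraic_setOf_eval_nonneg (R := ℝ) (σ.Pa j)
  refine soloInformed_isSemialgebraic_setOf_and (soloInformed_isSemialgebraic_setOf_forall fun i =>
    soloInformed_isSemialgebraic_setOf_forall_block (σ.isSemialgebraic_subSet (hS i) hD₀)
      fun _ => Iff.rfl) ?_
  refine soloInformed_isSemialgebraic_setOf_and (soloInformed_isSemialgebraic_setOf_forall fun i =>
    soloInformed_isSemialgebraic_setOf_forall fun i' => soloInformed_isSemialgebraic_setOf_imp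
      (soloInformed_isSemialgebraic_setOf_const _)
      (soloInformed_isSemialgebraic_setOf_thin ((hS i).inter (hS i')))) ?_
  refine soloInformed_isSemialgebraic_setOf_and
    (soloInformed_isSemialgebraic_setOf_thin (σ.isSemialgebraic_restFam hS hD₀)) ?_
  refine soloInformed_isSemialgebraic_setOf_and (soloInformed_isSemialgebraic_setOf_forall fun i =>
    soloInformed_isSemialgebraic_setOf_forall_block (σ.isSemialgebraic_exSet (hS i) (hG i))
      fun _ => Iff.rfl) ?_
  refine soloInformed_isSemialgebraic_setOf_and (soloInformed_isSemialgebraic_setOf_forall fun i =>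
    soloInformed_isSemialgebraic_setOf_forall_block (σ.isSemialgebraic_uniqSet (hS i) (hG i))
      fun _ => Iff.rfl) ?_
  refine soloInformed_isSemialgebraic_setOf_and (soloInformed_isSemialgebraic_setOf_forall fun i =>
    soloInformed_isSemialgebraic_setOf_forall_block (σ.isSemialgebraic_intoSet (hS i) (hG i))
      fun _ => Iff.rfl) ?_
  refine soloInformed_isSemialgebraic_setOf_and (soloInformed_isSemialgebraic_setOf_forall fun i =>
    soloInformed_isSemialgebraic_setOf_forall fun i' => soloInformed_isSemialgebraic_setOf_imp
      (soloInformed_isSemialgebraic_setOf_const _)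
      (soloInformed_isSemialgebraic_setOf_thin
        ((σ.isSemialgebraic_imgFam (hS i) (hG i)).inter
          (σ.isSemialgebraic_imgFam (hS i') (hG i'))))) ?_
  refine soloInformed_isSemialgebraic_setOf_and
    (soloInformed_isSemialgebraic_setOf_thin (σ.isSemialgebraic_imgRestFam hS hG)) ?_
  refine soloInformed_isSemialgebraic_setOf_and (soloInformed_isSemialgebraic_setOf_forall fun i =>
    soloInformed_isSemialgebraic_setOf_forall_block (σ.isSemialgebraic_injSet hS hG)
      fun _ => Iff.rfl) ?_
  exact soloInformed_isSemialgebraic_setOf_forall fun i =>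
    σ.isSemialgebraic_setOf_diffOK (hS i) (hG i)

/-- **What slack validity says**, in terms of pieces, images, relations and sides. [folklore] -/
theorem slackValid_iff {p : K → ℝ} : σ.SlackValid D₀ p ↔
    (∀ j, 0 ≤ σ.side p j) ∧
    (∀ i, σ.piece i p ⊆ D₀) ∧
    (∀ i i', i ≠ i' → interior (σ.piece i p ∩ σ.piece i' p) = ∅) ∧
    interior (D₀ \ ⋃ i, σ.piece i p) = ∅ ∧
    (∀ i x, x ∈ σ.piece i p → ∃ y, σ.rel i p x y) ∧
    (∀ i x y y', x ∈ σ.piece i p → σ.rel i p x y → σ.rel i p x y' → y = y') ∧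
    (∀ i x y, x ∈ σ.piece i p → σ.rel i p x y → y ∈ soloInformedTameBox (σ.side p)) ∧
    (∀ i i', i ≠ i' → interior (σ.img i p ∩ σ.img i' p) = ∅) ∧
    interior (soloInformedTameBox (σ.side p) \ ⋃ i, σ.img i p) = ∅ ∧
    (∀ i x x' y, x ∈ σ.piece i p → x' ∈ σ.piece i p → σ.rel i p x y → σ.rel i p x' y → x = x') ∧
    (∀ i, σ.DiffOK i p) := by
  have hPX : ∀ (x y : Fin n → ℝ), (Sum.elim (Sum.elim p x) y) ∘
      (Sum.elim (Sum.inl ∘ Sum.inl) (Sum.elim (Sum.inl ∘ Sum.inr) Sum.inr) :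
        K ⊕ (Fin n ⊕ Fin n) → (K ⊕ Fin n) ⊕ Fin n) = Sum.elim p (Sum.elim x y) := by
    intro x y; funext t; rcases t with l | j | j <;> rfl
  have h3a : ∀ z : Fin n ⊕ (Fin n ⊕ Fin n) → ℝ,
      (Sum.elim p z) ∘ (Sum.elim Sum.inl (Sum.inr ∘ Sum.inl) :
        K ⊕ Fin n → K ⊕ (Fin n ⊕ (Fin n ⊕ Fin n))) = Sum.elim p (fun j => z (Sum.inl j)) := by
    intro z; funext t; rcases t with l | j <;> rfl
  have h3b : ∀ z : Fin n ⊕ (Fin n ⊕ Fin n) → ℝ,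
      (Sum.elim p z) ∘ (Sum.elim Sum.inl (Sum.inr ∘ Sum.inr ∘ Sum.inl) :
        K ⊕ Fin n → K ⊕ (Fin n ⊕ (Fin n ⊕ Fin n))) =
        Sum.elim p (fun j => z (Sum.inr (Sum.inl j))) := by
    intro z; funext t; rcases t with l | j <;> rfl
  have h3c : ∀ z : Fin n ⊕ (Fin n ⊕ Fin n) → ℝ,
      (Sum.elim p z) ∘ (Sum.elim Sum.inl (Sum.elim (Sum.inr ∘ Sum.inl)
        (Sum.inr ∘ Sum.inr ∘ Sum.inl)) : K ⊕ (Fin n ⊕ Fin n) → K ⊕ (Fin n ⊕ (Fin n ⊕ Fin n)))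
        = Sum.elim p (Sum.elim (fun j => z (Sum.inl j)) (fun j => z (Sum.inr (Sum.inl j)))) := by
    intro z; funext t; rcases t with l | j | j <;> rfl
  have h3d : ∀ z : Fin n ⊕ (Fin n ⊕ Fin n) → ℝ,
      (Sum.elim p z) ∘ (Sum.elim Sum.inl (Sum.elim (Sum.inr ∘ Sum.inl)
        (Sum.inr ∘ Sum.inr ∘ Sum.inr)) : K ⊕ (Fin n ⊕ Fin n) → K ⊕ (Fin n ⊕ (Fin n ⊕ Fin n)))
        = Sum.elim p (Sum.elim (fun j => z (Sum.inl j)) (fun j => z (Sum.inr (Sum.inr j)))) := by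
    intro z; funext t; rcases t with l | j | j <;> rfl
  have h3e : ∀ z : Fin n ⊕ (Fin n ⊕ Fin n) → ℝ,
      (Sum.elim p z) ∘ (Sum.elim Sum.inl (Sum.elim (Sum.inr ∘ Sum.inr ∘ Sum.inl)
        (Sum.inr ∘ Sum.inr ∘ Sum.inr)) : K ⊕ (Fin n ⊕ Fin n) → K ⊕ (Fin n ⊕ (Fin n ⊕ Fin n)))
        = Sum.elim p (Sum.elim (fun j => z (Sum.inr (Sum.inl j)))
          (fun j => z (Sum.inr (Sum.inr j)))) := by
    intro z; funext t; rcases t with l | j | j <;> rfl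
  have h2a : ∀ z : Fin n ⊕ Fin n → ℝ,
      (Sum.elim p z) ∘ (Sum.elim Sum.inl (Sum.inr ∘ Sum.inl) : K ⊕ Fin n → K ⊕ (Fin n ⊕ Fin n))
        = Sum.elim p (fun j => z (Sum.inl j)) := by
    intro z; funext t; rcases t with l | j <;> rfl
  have h2b : ∀ z : Fin n ⊕ Fin n → ℝ,
      Sum.elim p z = Sum.elim p (Sum.elim (fun j => z (Sum.inl j)) (fun j => z (Sum.inr j))) := by
    intro z; funext t; rcases t with l | j | j <;> rfl
  have h2c : ∀ z : Fin n ⊕ Fin n → ℝ,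
      (Sum.elim p z) ∘ (Sum.inr ∘ Sum.inr : Fin n → K ⊕ (Fin n ⊕ Fin n)) =
        fun j => z (Sum.inr j) := by
    intro z; funext j; rfl
  simp only [SlackValid, soloInformed_thin_iff_interior_eq_empty, setOf_sumElim_mem_S_inter,
    setOf_sumElim_mem_restFam, setOf_sumElim_mem_imgFam_inter, setOf_sumElim_mem_imgRestFam,
    subSet, exSet, graphPX, uniqSet, intoSet, injSet, mem_setOf_eq, Sum.elim_comp_inr,
    Sum.elim_comp_inl, Sum.elim_inr, hPX, h3a, h3b, h3c, h3d, h3e, h2a, h2c]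
  refine and_congr Iff.rfl (and_congr ?_ (and_congr Iff.rfl (and_congr Iff.rfl (and_congr ?_
    (and_congr ?_ (and_congr ?_ (and_congr Iff.rfl (and_congr Iff.rfl (and_congr ?_
    Iff.rfl)))))))))
  · exact forall_congr' fun i => Iff.rfl
  · simp only [piece, rel, mem_setOf_eq]
  · refine forall_congr' fun i => ⟨fun h x y y' hx hy hy' => ?_, fun h z hx hy hy' => ?_⟩
    · have := h (Sum.elim x (Sum.elim y y')) (by simpa [piece] using hx) (by simpa [rel] using hy)
        (by simpa [rel] using hy')
      funext j
      simpa using this j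
    · exact fun j => congr_fun (h _ _ _ (by simpa [piece] using hx) (by simpa [rel] using hy)
        (by simpa [rel] using hy')) j
  · refine forall_congr' fun i => ⟨fun h x y hx hy => ?_, fun h z hx hy => ?_⟩
    · have := h (Sum.elim x y) (by simpa [piece] using hx) (by simpa [← h2b, rel] using hy)
      simpa using this
    · have := h _ _ (by simpa [piece] using hx) (by simp only [rel]; rw [← h2b]; exact hy)
      simpa using this
  · refine forall_congr' fun i => ⟨fun h x x' y hx hx' hy hy' => ?_, fun h z hx hx' hy hy' => ?_⟩
    · have := h (Sum.elim x (Sum.elim x' y)) (by simpa [piece] using hx)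
        (by simpa [piece] using hx') (by simpa [rel] using hy) (by simpa [rel] using hy')
      exact funext fun j => by simpa using this.2 j
    · have := h _ _ _ (by simpa [piece] using hx) (by simpa [piece] using hx')
        (by simpa [rel] using hy) (by simpa [rel] using hy')
      exact ⟨trivial, fun j => congr_fun this j⟩

end SoloInformedTameMapShape

end Summit.KontsevichZagierPeriods.KontsevichZagierPeriods.Theorems
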